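import Summits.ValiantsHypothesis.ValiantsHypothesis.Theorems.KPlusLogSqLawTropicalBSingleGaugeGeneric

/-!
# Route «KPlusLogSqLaw», crux `TropicalB` (stmt-ValiantsHypothesis-19771) — lemmas for the UNIVERSAL single-gauge bound

HONEST FRAMING.  Helper `--supports` the crux `Summit.ValiantsHypothesis.ValiantsHypothesis.Theses.KPlusLogSqLaw.TropicalB`
(item stmt-ValiantsHypothesis-19771, route KPlusLogSqLaw, DRAFT; cell `pub-symmetroid`, seat val-sym-trop-p5 g11, 2026-08-27).  Elementary
combinatorial lemmas used by `…SingleGaugeUniversal.lean` (`chain_le_of_universalGauge`: every chain certified by one generic affine row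
gauge has `n ≤ (K−2)m² + m`): the greedy interval-covering lemma, card bookkeeping, the universal per-token weight
`ψ = #{middle types of larger gauged slope} + [class ≠ top]` (antitone in the slope; token inequality), the cut inequalities, filter cards
under a permutation, the count of middle types.  Nothing here bears on `TropicalB` in its window, `WeakLifting`, the doors, `MatrixDescartes`
(stmt-ValiantsHypothesis-18050) or VP ≠ VNP. [this seat; all folklore-level]
-/

set_option linter.dupNamespace false
set_option autoImplicit false

namespace Summit.ValiantsHypothesis.ValiantsHypothesis.Theorems.KPlusLogSqLaw

open Summit.ValiantsHypothesis.ValiantsHypothesis.Theorems.MatrixDescartes.Negative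
open scoped BigOperators
open Finset

namespace SingleGauge

variable {m K : ℕ}

/-- **Interval-covering lemma (greedy).**  Blocks `s ∈ B` are nonempty intervals `(L s, U s]` with `U` injective on `B` and `L, U`
co-monotone; intervals `w ∈ R` are `(o w, n w]`.  If the right end `U s` of every block is covered by at least as many `R`-intervals as there
are blocks containing it, and every `R`-interval covering `U s` starts strictly inside the block (`L s < o w`), then
`B.card ≤ #{w ∈ R : ∃ s ∈ B, L s < o w}`. [elementary; greedy from the top block] -/
theorem card_le_card_coverers {ι κ : Type*} [DecidableEq ι] [DecidableEq κ] (L U : ι → ℚ) (o n : κ → ℚ) :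
    ∀ (N : ℕ) (B : Finset ι) (R : Finset κ), B.card = N →
    (∀ s ∈ B, L s < U s) →
    (∀ s ∈ B, ∀ s' ∈ B, U s ≤ U s' → L s ≤ L s') →
    (∀ s ∈ B, ∀ s' ∈ B, U s = U s' → s = s') →
    (∀ s ∈ B, (B.filter (fun s' => L s' < U s ∧ U s ≤ U s')).card ≤ (R.filter (fun w => o w < U s ∧ U s ≤ n w)).card) →
    (∀ s ∈ B, ∀ w ∈ R, o w < U s → U s ≤ n w → L s < o w) →
    B.card ≤ (R.filter (fun w => ∃ s ∈ B, L s < o w)).card := by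
  intro N
  induction N with
  | zero => intro B R hB _ _ _ _ _; rw [hB]; exact Nat.zero_le _
  | succ N ih =>
    intro B R hB hLU hmono hinj hcover hnc
    have hne : B.Nonempty := by rw [← card_pos, hB]; exact Nat.succ_pos N
    obtain ⟨s0, hs0, hmax⟩ := exists_max_image B U hne
    -- s0 counts itself, so U s0 has a coverer w0
    have hpos : 0 < (R.filter (fun w => o w < U s0 ∧ U s0 ≤ n w)).card := by
      refine lt_of_lt_of_le ?_ (hcover s0 hs0)
      rw [card_pos]; exact ⟨s0, by rw [mem_filter]; exact ⟨hs0, hLU s0 hs0, le_rfl⟩⟩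
    obtain ⟨w0, hw0⟩ := card_pos.mp hpos
    rw [mem_filter] at hw0
    obtain ⟨hw0R, hw0o, hw0n⟩ := hw0
    have hL0 : L s0 < o w0 := hnc s0 hs0 w0 hw0R hw0o hw0n
    -- induction on the smaller instance
    set B' := B.erase s0 with hB'
    set R' := R.erase w0 with hR'
    have hB'card : B'.card = N := by rw [hB', card_erase_of_mem hs0, hB]; rfl
    have hcover' : ∀ s ∈ B', (B'.filter (fun s' => L s' < U s ∧ U s ≤ U s')).card ≤
        (R'.filter (fun w => o w < U s ∧ U s ≤ n w)).card := by
      intro s hs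
      have hsB : s ∈ B := mem_of_mem_erase hs
      have hsne : s ≠ s0 := ne_of_mem_erase hs
      have hUs : U s < U s0 := lt_of_le_of_ne (hmax s hsB) (fun h => hsne (hinj s hsB s0 hs0 h))
      -- removing s0 from the block count costs exactly [L s0 < U s]; removing w0 from the coverers costs at most that
      have hc := hcover s hsB
      by_cases hw : o w0 < U s ∧ U s ≤ n w0
      · -- then s0's block contains U s, so both counts drop by one
        have hs0in : s0 ∈ B.filter (fun s' => L s' < U s ∧ U s ≤ U s') := by
          rw [mem_filter]; exact ⟨hs0, hL0.trans hw.1, hUs.le⟩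
        have h1 : (B'.filter (fun s' => L s' < U s ∧ U s ≤ U s')).card + 1 =
            (B.filter (fun s' => L s' < U s ∧ U s ≤ U s')).card := by
          rw [hB', filter_erase, card_erase_of_mem hs0in]
          exact Nat.sub_add_cancel (card_pos.mpr ⟨s0, hs0in⟩)
        have hw0in : w0 ∈ R.filter (fun w => o w < U s ∧ U s ≤ n w) := by rw [mem_filter]; exact ⟨hw0R, hw⟩
        have h2 : (R'.filter (fun w => o w < U s ∧ U s ≤ n w)).card + 1 =
            (R.filter (fun w => o w < U s ∧ U s ≤ n w)).card := by
          rw [hR', filter_erase, card_erase_of_mem hw0in]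
          exact Nat.sub_add_cancel (card_pos.mpr ⟨w0, hw0in⟩)
        omega
      · have h2 : (R'.filter (fun w => o w < U s ∧ U s ≤ n w)) = (R.filter (fun w => o w < U s ∧ U s ≤ n w)) := by
          rw [hR', filter_erase]; apply erase_eq_of_notMem; rw [mem_filter]; exact fun h => hw h.2
        have h1 : (B'.filter (fun s' => L s' < U s ∧ U s ≤ U s')).card ≤ (B.filter (fun s' => L s' < U s ∧ U s ≤ U s')).card := by
          rw [hB', filter_erase]; exact card_erase_le
        rw [h2]; exact h1.trans hc
    have ih' := ih B' R' hB'card (fun s hs => hLU s (mem_of_mem_erase hs))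
      (fun s hs s' hs' => hmono s (mem_of_mem_erase hs) s' (mem_of_mem_erase hs'))
      (fun s hs s' hs' => hinj s (mem_of_mem_erase hs) s' (mem_of_mem_erase hs')) hcover'
      (fun s hs w hw => hnc s (mem_of_mem_erase hs) w (mem_of_mem_erase hw))
    -- the counted set for (B, R) contains the counted set for (B', R') and w0 on top
    have hsub : insert w0 (R'.filter (fun w => ∃ s ∈ B', L s < o w)) ⊆ R.filter (fun w => ∃ s ∈ B, L s < o w) := by
      intro w hw
      rw [mem_insert] at hw
      rw [mem_filter]
      rcases hw with rfl | hw
      · exact ⟨hw0R, s0, hs0, hL0⟩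
      · rw [mem_filter] at hw
        obtain ⟨hwR', s, hs, hLs⟩ := hw
        exact ⟨mem_of_mem_erase hwR', s, mem_of_mem_erase hs, hLs⟩
    have hnot : w0 ∉ R'.filter (fun w => ∃ s ∈ B', L s < o w) := by
      rw [mem_filter, hR']; exact fun h => notMem_erase w0 R h.1
    have hcl := card_le_card hsub
    rw [card_insert_of_notMem hnot] at hcl
    have hB'c : B'.card = N := hB'card
    rw [hB]
    have : N ≤ (R'.filter (fun w => ∃ s ∈ B', L s < o w)).card := hB'c ▸ ih'
    omega

/-- card bookkeeping: if `Q ⊆ X` and `P.card = X.card` then `(Q \\ P).card ≤ (P \\ Q).card`. [folklore] -/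
theorem card_sdiff_le_card_sdiff {α : Type*} [DecidableEq α] (P Q X : Finset α) (hQX : Q ⊆ X) (hPX : P.card = X.card) :
    (Q \ P).card ≤ (P \ Q).card := by
  have h1 : (P \ Q).card + Q.card = (P ∪ Q).card := card_sdiff_add_card P Q
  have h2 : (Q \ P).card + P.card = (Q ∪ P).card := card_sdiff_add_card Q P
  have h3 : (P ∪ Q) = (Q ∪ P) := union_comm _ _
  have h4 : Q.card ≤ X.card := card_le_card hQX
  rw [h3] at h1
  omega

/-- the universal weight of a gauged-slope value `γ` seen from row `i`: the number of MIDDLE incidence types (class `≠ l₀, l₁`) with larger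
gauged slope, plus one unless `γ` is the top slope `d l₁ − α i` of the row.  (No definition: an explicit expression passed around.) -/
theorem psiU_antitone (d : Fin K → ℕ) (α : Fin m → ℚ) (l₀ l₁ : Fin K) (i : Fin m) {γ γ' : ℚ} (h : γ ≤ γ') :
    ((univ.filter fun il : Fin m × Fin K => il.2 ≠ l₀ ∧ il.2 ≠ l₁ ∧ γ' < (d il.2 : ℚ) - α il.1).card : ℤ) +
        (if γ' < (d l₁ : ℚ) - α i then 1 else 0) ≤
      ((univ.filter fun il : Fin m × Fin K => il.2 ≠ l₀ ∧ il.2 ≠ l₁ ∧ γ < (d il.2 : ℚ) - α il.1).card : ℤ) +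
        (if γ < (d l₁ : ℚ) - α i then 1 else 0) := by
  have hsub : (univ.filter fun il : Fin m × Fin K => il.2 ≠ l₀ ∧ il.2 ≠ l₁ ∧ γ' < (d il.2 : ℚ) - α il.1) ⊆
      (univ.filter fun il : Fin m × Fin K => il.2 ≠ l₀ ∧ il.2 ≠ l₁ ∧ γ < (d il.2 : ℚ) - α il.1) := by
    intro il hil; rw [mem_filter] at hil ⊢; exact ⟨hil.1, hil.2.1, hil.2.2.1, lt_of_le_of_lt h hil.2.2.2⟩
  have h1 : ((univ.filter fun il : Fin m × Fin K => il.2 ≠ l₀ ∧ il.2 ≠ l₁ ∧ γ' < (d il.2 : ℚ) - α il.1).card : ℤ) ≤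
      ((univ.filter fun il : Fin m × Fin K => il.2 ≠ l₀ ∧ il.2 ≠ l₁ ∧ γ < (d il.2 : ℚ) - α il.1).card : ℤ) := by
    exact_mod_cast card_le_card hsub
  have h2 : (if γ' < (d l₁ : ℚ) - α i then (1:ℤ) else 0) ≤ (if γ < (d l₁ : ℚ) - α i then 1 else 0) := by
    by_cases ha : γ' < (d l₁ : ℚ) - α i
    · have hb : γ < (d l₁ : ℚ) - α i := lt_of_le_of_lt h ha
      rw [if_pos ha, if_pos hb]
    · rw [if_neg ha]; split_ifs <;> norm_num
  linarith

/-- **token inequality.**  Moving from the type `(i,l)` to a gauged slope `γ'` of row `i'` that is a type of that row and strictly larger: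
the weight drops by at least `[old class not top] − [landing at the bottom slope of row i']`. -/
theorem psiU_drop (d : Fin K → ℕ) (α : Fin m → ℚ) (l₀ l₁ : Fin K)
    (i i' : Fin m) (l f : Fin K) (hlt : (d l : ℚ) - α i < (d f : ℚ) - α i') :
    ((univ.filter fun il : Fin m × Fin K => il.2 ≠ l₀ ∧ il.2 ≠ l₁ ∧ ((d f : ℚ) - α i') < (d il.2 : ℚ) - α il.1).card : ℤ) +
        (if ((d f : ℚ) - α i') < (d l₁ : ℚ) - α i' then 1 else 0) +
      ((if ((d l : ℚ) - α i) < (d l₁ : ℚ) - α i then 1 else 0) - (if f = l₀ then 1 else 0)) ≤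
      ((univ.filter fun il : Fin m × Fin K => il.2 ≠ l₀ ∧ il.2 ≠ l₁ ∧ ((d l : ℚ) - α i) < (d il.2 : ℚ) - α il.1).card : ℤ) +
        (if ((d l : ℚ) - α i) < (d l₁ : ℚ) - α i then 1 else 0) := by
  -- the new type (i', f) is counted on the old side and not on the new side when it is a middle type
  set Sold := (univ.filter fun il : Fin m × Fin K => il.2 ≠ l₀ ∧ il.2 ≠ l₁ ∧ ((d l : ℚ) - α i) < (d il.2 : ℚ) - α il.1) with hSold
  set Snew := (univ.filter fun il : Fin m × Fin K => il.2 ≠ l₀ ∧ il.2 ≠ l₁ ∧ ((d f : ℚ) - α i') < (d il.2 : ℚ) - α il.1) with hSnew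
  have hsub : Snew ⊆ Sold := by
    intro il hil; rw [hSnew, mem_filter] at hil; rw [hSold, mem_filter]
    exact ⟨hil.1, hil.2.1, hil.2.2.1, hlt.trans hil.2.2.2⟩
  have hle : (Snew.card : ℤ) ≤ Sold.card := by exact_mod_cast card_le_card hsub
  by_cases hf0 : f = l₀
  · -- landing at the bottom: no middle gain needed
    rw [if_pos hf0]
    have : (if ((d f : ℚ) - α i') < (d l₁ : ℚ) - α i' then (1:ℤ) else 0) ≤ 1 := by split_ifs <;> norm_num
    have : (0:ℤ) ≤ (if ((d l : ℚ) - α i) < (d l₁ : ℚ) - α i then (1:ℤ) else 0) := by split_ifs <;> norm_num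
    linarith
  · rw [if_neg hf0, sub_zero]
    by_cases hf1 : f = l₁
    · -- landing at the top of row i': the new indicator is 0
      have hno : ¬ ((d f : ℚ) - α i' < (d l₁ : ℚ) - α i') := by rw [hf1]; exact lt_irrefl _
      rw [if_neg hno, add_zero]
      have : (0:ℤ) ≤ (if ((d l : ℚ) - α i) < (d l₁ : ℚ) - α i then (1:ℤ) else 0) := by split_ifs <;> norm_num
      linarith
    · -- middle landing: (i', f) ∈ Sold \ Snew gives a strict card drop
      have hmem : (i', f) ∈ Sold := by rw [hSold, mem_filter]; exact ⟨mem_univ _, hf0, hf1, hlt⟩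
      have hnmem : (i', f) ∉ Snew := by rw [hSnew, mem_filter]; exact fun h => lt_irrefl _ h.2.2.2
      have hss : Snew ⊂ Sold := ssubset_iff_of_subset hsub |>.mpr ⟨(i', f), hmem, hnmem⟩
      have hlt' : (Snew.card : ℤ) + 1 ≤ Sold.card := by have := card_lt_card hss; omega
      have h1 : (if ((d f : ℚ) - α i') < (d l₁ : ℚ) - α i' then (1:ℤ) else 0) ≤ 1 := by split_ifs <;> norm_num
      have h2 : (if ((d l : ℚ) - α i) < (d l₁ : ℚ) - α i then (1:ℤ) else 0) ≤ 1 := by split_ifs <;> norm_num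
      have h3 : (0:ℤ) ≤ (if ((d l : ℚ) - α i) < (d l₁ : ℚ) - α i then (1:ℤ) else 0) := by split_ifs <;> norm_num
      linarith


/-- cut inequality: if `gx j < gy j` on `C` and `#{j ∈ C : go j < q} = #{j ∈ C : gx j < q}`, then the «dropping coverers» of `q` are at most the
«rising coverers». [card arithmetic] -/
theorem cut_le (C : Finset (Fin m)) (gx gy go : Fin m → ℚ) (q : ℚ) (hxy : ∀ j ∈ C, gx j < gy j)
    (hcard : (C.filter fun j => go j < q).card = (C.filter fun j => gx j < q).card) :
    (C.filter fun j => gy j < q ∧ q ≤ go j).card ≤ (C.filter fun j => go j < q ∧ q ≤ gy j).card := by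
  have hQX : (C.filter fun j => gy j < q) ⊆ (C.filter fun j => gx j < q) := by
    intro j hj; rw [mem_filter] at hj ⊢; exact ⟨hj.1, (hxy j hj.1).trans hj.2⟩
  have h := card_sdiff_le_card_sdiff (C.filter fun j => go j < q) (C.filter fun j => gy j < q) (C.filter fun j => gx j < q) hQX hcard
  have e1 : (C.filter fun j => gy j < q) \ (C.filter fun j => go j < q) = (C.filter fun j => gy j < q ∧ q ≤ go j) := by
    ext j; simp only [mem_sdiff, mem_filter, not_and, not_lt]; constructor
    · rintro ⟨⟨hC, h1⟩, h2⟩; exact ⟨hC, h1, h2 hC⟩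
    · rintro ⟨hC, h1, h2⟩; exact ⟨⟨hC, h1⟩, fun _ => h2⟩
  have e2 : (C.filter fun j => go j < q) \ (C.filter fun j => gy j < q) = (C.filter fun j => go j < q ∧ q ≤ gy j) := by
    ext j; simp only [mem_sdiff, mem_filter, not_and, not_lt]; constructor
    · rintro ⟨⟨hC, h1⟩, h2⟩; exact ⟨hC, h1, h2 hC⟩
    · rintro ⟨hC, h1, h2⟩; exact ⟨⟨hC, h1⟩, fun _ => h2⟩
  rw [e1, e2] at h; exact h

/-- the same with non-strict cuts. [card arithmetic] -/
theorem cut_le' (C : Finset (Fin m)) (gx gy go : Fin m → ℚ) (q : ℚ) (hxy : ∀ j ∈ C, gx j < gy j)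
    (hcard : (C.filter fun j => go j ≤ q).card = (C.filter fun j => gx j ≤ q).card) :
    (C.filter fun j => gy j ≤ q ∧ q < go j).card ≤ (C.filter fun j => go j ≤ q ∧ q < gy j).card := by
  have hQX : (C.filter fun j => gy j ≤ q) ⊆ (C.filter fun j => gx j ≤ q) := by
    intro j hj; rw [mem_filter] at hj ⊢; exact ⟨hj.1, ((hxy j hj.1).le.trans hj.2)⟩
  have h := card_sdiff_le_card_sdiff (C.filter fun j => go j ≤ q) (C.filter fun j => gy j ≤ q) (C.filter fun j => gx j ≤ q) hQX hcard
  have e1 : (C.filter fun j => gy j ≤ q) \ (C.filter fun j => go j ≤ q) = (C.filter fun j => gy j ≤ q ∧ q < go j) := by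
    ext j; simp only [mem_sdiff, mem_filter, not_and, not_le]; constructor
    · rintro ⟨⟨hC, h1⟩, h2⟩; exact ⟨hC, h1, h2 hC⟩
    · rintro ⟨hC, h1, h2⟩; exact ⟨⟨hC, h1⟩, fun _ => h2⟩
  have e2 : (C.filter fun j => go j ≤ q) \ (C.filter fun j => gy j ≤ q) = (C.filter fun j => go j ≤ q ∧ q < gy j) := by
    ext j; simp only [mem_sdiff, mem_filter, not_and, not_le]; constructor
    · rintro ⟨⟨hC, h1⟩, h2⟩; exact ⟨hC, h1, h2 hC⟩
    · rintro ⟨hC, h1, h2⟩; exact ⟨⟨hC, h1⟩, fun _ => h2⟩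
  rw [e1, e2] at h; exact h



/-- cards of filters are invariant under a permutation preserving the ambient finset. [folklore] -/
theorem card_filter_perm {m : ℕ} (S : Finset (Fin m)) (π : Equiv.Perm (Fin m)) (hS : ∀ j, π j ∈ S ↔ j ∈ S)
    (P : Fin m → Prop) [DecidablePred P] :
    (S.filter fun j => P (π j)).card = (S.filter P).card := by
  refine card_bij (fun j _ => π j) ?_ ?_ ?_
  · intro j hj; rw [mem_filter] at hj ⊢; exact ⟨(hS j).mpr hj.1, hj.2⟩
  · intro j₁ _ j₂ _ h; exact π.injective h
  · intro i hi; rw [mem_filter] at hi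
    refine ⟨π.symm i, ?_, by simp⟩
    rw [mem_filter]; refine ⟨?_, ?_⟩
    · have := hS (π.symm i); rw [Equiv.apply_symm_apply] at this; exact this.mp hi.1
    · show P (π (π.symm i)); rw [Equiv.apply_symm_apply]; exact hi.2

/-- the number of MIDDLE incidence types: `m·(K−2)`. -/
theorem card_types_mid (l₀ l₁ : Fin K) (h : l₀ ≠ l₁) :
    (univ.filter fun il : Fin m × Fin K => il.2 ≠ l₀ ∧ il.2 ≠ l₁).card = m * (K - 2) := by
  have hl : l₁ ∈ univ.erase l₀ := by rw [mem_erase]; exact ⟨fun e => h e.symm, mem_univ _⟩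
  have : (univ.filter fun il : Fin m × Fin K => il.2 ≠ l₀ ∧ il.2 ≠ l₁) =
      (univ : Finset (Fin m)) ×ˢ ((univ.erase l₀).erase l₁) := by
    ext ⟨i, l⟩
    simp only [mem_filter, mem_univ, true_and, mem_product, mem_erase, ne_eq, and_true]
    tauto
  rw [this, card_product, card_univ, Fintype.card_fin, card_erase_of_mem hl, card_erase_of_mem (mem_univ _), card_univ,
    Fintype.card_fin]
  have : K - 1 - 1 = K - 2 := by omega
  rw [this]


/-- telescoping: an integer potential that drops by `≥ 1` at each of `n` steps, is `≥ 0` at the end and `≤ B` at the start forces `n ≤ B`. -/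
theorem le_of_potential {n : ℕ} (Φ : Fin (n + 1) → ℤ) (B : ℤ) (hstep : ∀ k : Fin n, Φ k.succ + 1 ≤ Φ k.castSucc)
    (h0 : Φ 0 ≤ B) (hnn : 0 ≤ Φ (Fin.last n)) : (n : ℤ) ≤ B := by
  have htel : ∀ k : Fin (n + 1), Φ k + (k : ℤ) ≤ Φ 0 := by
    intro k
    induction k using Fin.induction with
    | zero => simp
    | succ k ih =>
      have := hstep k
      have hv : ((k.succ : Fin (n + 1)) : ℤ) = ((k.castSucc : Fin (n + 1)) : ℤ) + 1 := by simp [Fin.val_succ]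
      rw [hv]; linarith
  have hlast := htel (Fin.last n)
  have hl : ((Fin.last n : Fin (n + 1)) : ℤ) = n := by simp
  rw [hl] at hlast
  linarith

/-- the row permutation `π = σ_b ; σ_a⁻¹` preserves the set of row-changed columns. -/
theorem perm_mem_rowChanged_iff {m : ℕ} (σa σb : Equiv.Perm (Fin m)) (j : Fin m) :
    (σb.trans σa.symm) j ∈ (univ.filter fun j => σa j ≠ σb j) ↔ j ∈ (univ.filter fun j => σa j ≠ σb j) := by
  have hπ : σa ((σb.trans σa.symm) j) = σb j := by simp
  have hfix : (σb.trans σa.symm) j = j ↔ σa j = σb j := by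
    constructor
    · intro h; rw [h] at hπ; exact hπ
    · intro h; apply σa.injective; rw [hπ]; exact h.symm
  simp only [mem_filter, mem_univ, true_and]
  rw [hπ]
  constructor
  · intro h heq; exact h (by rw [hfix.mpr heq])
  · intro h heq; exact h (hfix.mp (σb.injective heq).symm)

end SingleGauge

end Summit.ValiantsHypothesis.ValiantsHypothesis.Theorems.KPlusLogSqLaw
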